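import Summits.Parity.GeneralizedHardyLittlewood.Theses.LeeYangFibres
import HarnessLib

/-!
# Route `LeeYangFibres`, crux `RelativeDimOne` (stmt-Parity-14113): vocabulary of the line
`SketchIdeator1` = card `translate-amplification`

Route-posited objects (D-0016 `<Route><Crux>Defs` file) shared by the registered stubs of the skeleton
`Cruxes/RelativeDimOne/Lines/SketchIdeator1.lean` (line lead `prover-line-stmt-Parity-14113-0`) and by the crux
file that composes them. NOTHING IS ASSERTED: every `def … : Prop` below is a *statement* — the type of a
registered stub (`stub_localAverage`, `stub_singularTail`, `stub_degenerateCount`, `stub_archFacts`,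
`stub_singularMeanGlue`, `stub_amplification`, `stub_coarseHLSlack`) or of the identity `CompleteSum`, which is PROVED here (`completeSum`, the registered sub-goal this file
lands under) — consumed only as the type of a stub theorem or as an explicit hypothesis.

THE LINE (idea card `Cruxes/RelativeDimOne/Ideas/translate-amplification.md`): the tensor-power trick over
TRANSLATE-CONSTELLATIONS. For a `t`-system `Ψ` of one-dimensional forms and a shift vector `H ∈ ℤ^m` put
`Ψ^{(H)} := Ψ ⊔ (Ψ + H₁) ⊔ ⋯ ⊔ (Ψ + H_m)` (`translateFamily Ψ H`, an `(m+1)t`-system of the same slopes,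
`‖Ψ^{(H)}‖_N ≤ (3m+1)L` on the shift box `|H_j| ≤ 2N`) on `K_H := K ∩ ⋂_j (K − H_j)` (`meetTranslates K H`).
The COMPLETE SUM over all shift vectors is exact, `∑_{H ∈ [-2N,2N]^m} S(Ψ^{(H)}, K_H) = S(Ψ,K)^{m+1}`
(`CompleteSum`); the main terms average (Gallagher), `∑_{H nondeg} β_∞(Ψ^{(H)},K_H) 𝔖(Ψ^{(H)}) =
(β_∞ 𝔖)^{m+1}(1 + o(1)) + o(N^{m+1})` (`SingularMean`, from `LocalAverage`, `SingularTail`, `DegenerateCount`,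
`ArchFacts` through `SingularMeanGlue`); hence two-sided ORDER-OF-MAGNITUDE bounds for prime constellations
with sub-exponential loss in the number of forms and `o(N)` slack (`CoarseHLSlack`, the line's single
conjectural input, equivalent to the crux) amplify under `(m+1)`-th roots to the exact asymptotic
(`Amplification : CompleteSum → SingularMean → DegenerateCount → CoarseHLSlack → RelativeDimOne`).

References: Green–Tao, Ann. of Math. 171 (2010), Conj. 1.2/1.4, (1.1)–(1.7) [GreenTao2010]; Gallagher,
Mathematika 23 (1976), (3) and §2 [Gallagher1976]; Tao–Vu, *Additive Combinatorics* (tensor power trick).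
-/

noncomputable section

open scoped BigOperators Classical Topology
open Finset Filter MeasureTheory Literature.NumberTheory.Sieve
open Summit.Parity.GeneralizedHardyLittlewood.Theses.LeeYangFibres (RelativeDimOne)

namespace Summit.Parity.GeneralizedHardyLittlewood.Cruxes.RelativeDimOne.TranslateAmplification

variable {t m : ℕ}

/-! ### Vocabulary: translate-constellations -/

/-- The shift vector `H' = (0, H₁, …, H_m)` of a shift `H ∈ ℤ^m` (`H'_0 = 0` is the unshifted copy). -/
def shiftVec (H : Fin m → ℤ) : Fin (m + 1) → ℤ := Fin.cons 0 H

/-- `H'_0 = 0`. -/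
@[simp] theorem shiftVec_zero (H : Fin m → ℤ) : shiftVec H 0 = 0 := by
  simp [shiftVec]

/-- `H'_{j+1} = H_j`. -/
@[simp] theorem shiftVec_succ (H : Fin m → ℤ) (j : Fin m) : shiftVec H j.succ = H j := by
  simp [shiftVec]

/-- The translate `ψ(· + h)` of a one-dimensional form `ψ(n) = a n + b`: coefficients `a`, constant
`b + a h`. -/
def translateForm (ψ : AffLinForm 1) (h : ℤ) : AffLinForm 1 :=
  ⟨ψ.coeff, ψ.const + ψ.coeff 0 * h⟩

/-- `(ψ(· + h))(n) = ψ(n + h)`. -/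
theorem translateForm_eval (ψ : AffLinForm 1) (h : ℤ) (n : Fin 1 → ℤ) :
    (translateForm ψ h).eval n = ψ.eval (fun j => n j + h) := by
  simp [translateForm, AffLinForm.eval]
  ring

/-- The real extension of the translate is the translate of the real extension. -/
theorem translateForm_realEval (ψ : AffLinForm 1) (h : ℤ) (x : Fin 1 → ℝ) :
    (translateForm ψ h).realEval x = ψ.realEval (fun j => x j + (h : ℝ)) := by
  simp [translateForm, AffLinForm.realEval]
  ring

/-- The TRANSLATE-CONSTELLATION `Ψ^{(H)} = Ψ ⊔ (Ψ + H₁) ⊔ ⋯ ⊔ (Ψ + H_m)`: the `(m+1)t`-system whose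
form with index `(j, i)` (through `finProdFinEquiv : Fin (m+1) × Fin t ≃ Fin ((m+1) t)`) is
`ψ_i(· + H'_j)`. -/
def translateFamily (Ψ : Fin t → AffLinForm 1) (H : Fin m → ℤ) : Fin ((m + 1) * t) → AffLinForm 1 :=
  fun k => translateForm (Ψ (finProdFinEquiv.symm k).2) (shiftVec H (finProdFinEquiv.symm k).1)

/-- The form of `Ψ^{(H)}` with index `(j, i)` is `ψ_i(· + H'_j)`. -/
@[simp] theorem translateFamily_apply (Ψ : Fin t → AffLinForm 1) (H : Fin m → ℤ) (j : Fin (m + 1))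
    (i : Fin t) : translateFamily Ψ H (finProdFinEquiv (j, i)) = translateForm (Ψ i) (shiftVec H j) := by
  simp [translateFamily]

/-- `K_H = K ∩ ⋂_j (K − H_j)`: the points `x` with `x + H'_j ∈ K` for every `j` (including `j = 0`). -/
def meetTranslates (K : Set (Fin 1 → ℝ)) (H : Fin m → ℤ) : Set (Fin 1 → ℝ) :=
  {x | ∀ j : Fin (m + 1), (fun l => x l + (shiftVec H j : ℝ)) ∈ K}

/-- The shift box `[-2N, 2N]^m ∩ ℤ^m` (outside it `K_H = ∅` for `K ⊆ [-N, N]`). -/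
def shiftBox (m N : ℕ) : Finset (Fin m → ℤ) :=
  Fintype.piFinset fun _ : Fin m => Finset.Icc (-(2 * N : ℤ)) (2 * N)

/-- The truncation level `y_N = ⌊log N / 4⌋` of the singular product (`primorial y_N ≤ 4^{y_N} ≤ N^{0.35}`). -/
def truncLevel (N : ℕ) : ℕ := ⌊Real.log N / 4⌋₊

/-! ### The statements of the line (types of the registered stubs; nothing is asserted here) -/

/-- B1 (m-fold COMPLETE-SUM IDENTITY): summing the von Mangoldt sums of the translate-constellations
over ALL shifts `H ∈ [-2N,2N]^m` gives exactly `S(Ψ, K)^{m+1}` (reindex `m_j = n + H_j`). PROVED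
below (`completeSum`). -/
def CompleteSum : Prop :=
  ∀ (m t N : ℕ) (Ψ : Fin t → AffLinForm 1) (K : Set (Fin 1 → ℝ)), K ⊆ realBox 1 N →
    ∑ H ∈ shiftBox m N, vonMangoldtSum (translateFamily Ψ H) (meetTranslates K H) N
      = vonMangoldtSum Ψ K N ^ (m + 1)

/-- B2a (LOCAL FACTORS MULTIPLY EXACTLY ON AVERAGE): for a finite set of primes `S` with product `P`
and any integer box `∏_j [a_j, a_j + P)`,
`∑_{H ∈ box} ∏_{p ∈ S} β_p(Ψ^{(H)}) = P^m ∏_{p ∈ S} β_p(Ψ)^{m+1}`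
(`β_p(Ψ^{(H)})` is `p`-periodic in each `H_j`; `𝔼_{H mod p} β_p(Ψ^{(H)}) = β_p(Ψ)^{m+1}` by the shift
`n ↦ n + H_j` of `ℤ/p`; then the Chinese remainder theorem). -/
def LocalAverage : Prop :=
  ∀ (m t : ℕ) (Ψ : Fin t → AffLinForm 1) (S : Finset ℕ), (∀ p ∈ S, p.Prime) → ∀ a : Fin m → ℤ,
    ∑ H ∈ Fintype.piFinset (fun j : Fin m => Finset.Ico (a j) (a j + ∏ p ∈ S, (p : ℤ))),
        ∏ p ∈ S, localFactor (translateFamily Ψ H) p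
      = ((∏ p ∈ S, p : ℕ) : ℝ) ^ m * ∏ p ∈ S, localFactor Ψ p ^ (m + 1)

/-- B2b (UNIFORM TAILS OF THE SINGULAR PRODUCT, `d = 1`): uniformly over non-degenerate systems of `T`
forms with `‖Φ‖_N ≤ L`, `𝔖(Φ) = (1 + O(δ)) ∏_{p ≤ y_N} β_p(Φ)` for `N ≥ N₀(T, L, δ)`, `y_N = truncLevel N`
(generic primes `p > y_N` have `T` distinct roots and `β_p = 1 + O(T²/p²)`; the primes dividing a
non-zero cross-discriminant `a_i b_k − a_k b_i`, `≤ T² log(2L²N)/log y_N` of them, have `|β_p − 1| ≤ 2T/p`). -/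
def SingularTail : Prop :=
  ∀ (T L : ℕ), ∀ δ : ℝ, 0 < δ → ∃ N₀ : ℕ, ∀ N : ℕ, N₀ ≤ N →
    ∀ Φ : Fin T → AffLinForm 1, IsNondegenerateSystem Φ → affLinSize Φ N ≤ L →
      |singularProduct Φ - singularProductPartial Φ (truncLevel N)| ≤
        δ * singularProductPartial Φ (truncLevel N)

/-- B3 (DEGENERATE SHIFTS ARE FEW): for a non-degenerate `Ψ`, the shifts `H ∈ [-2N,2N]^m` for which
`Ψ^{(H)}` is degenerate number `≤ C_{m,t} (4N+1)^{m-1}` (two forms `ψ_i(· + H'_j)`, `ψ_k(· + H'_{j'})`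
are rational multiples of each other only if `j ≠ j'` and `a_i a_k (H'_j − H'_{j'}) = a_i b_k − a_k b_i`,
one hyperplane per pair of indices). -/
def DegenerateCount : Prop :=
  ∀ (m t : ℕ), ∃ C : ℝ, ∀ (N : ℕ) (Ψ : Fin t → AffLinForm 1), IsNondegenerateSystem Ψ →
    (((shiftBox m N).filter (fun H => ¬ IsNondegenerateSystem (translateFamily Ψ H))).card : ℝ) ≤
      C * ((4 * N + 1 : ℕ) : ℝ) ^ (m - 1)

/-- B4 (ARCHIMEDEAN WEIGHTS): for a convex `I ⊆ [-N, N]` (an interval), the volumes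
`w(H) = vol(I ∩ ⋂_j (I − H_j))` sum over the shift box to `vol(I)^{m+1} + O_m((N+1)^m)` (for `x ∈ I`,
`#{h ∈ ℤ : x + h ∈ I} = vol(I) + O(1)`) and are `2`-Lipschitz in each `H_j`. Used with
`I = K ∩ {Ψ > 0}`, where `w(H) = β_∞(Ψ^{(H)}, K_H)`. -/
def ArchFacts : Prop :=
  ∀ m : ℕ, ∃ C : ℝ, ∀ (N : ℕ) (I : Set (Fin 1 → ℝ)), Convex ℝ I → I ⊆ realBox 1 N →
    |∑ H ∈ shiftBox m N, (volume (meetTranslates I H)).toReal - (volume I).toReal ^ (m + 1)| ≤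
        C * ((N : ℝ) + 1) ^ m ∧
      ∀ H H' : Fin m → ℤ, |(volume (meetTranslates I H)).toReal - (volume (meetTranslates I H')).toReal| ≤
        2 * ∑ j, |((H j : ℤ) : ℝ) - (H' j : ℝ)|

/-- B2 (GALLAGHER AVERAGING FOR TRANSLATE-CONSTELLATIONS): the main terms
`M_H = β_∞(Ψ^{(H)}, K_H) 𝔖(Ψ^{(H)})` of the NON-DEGENERATE translate-constellations sum to
`(β_∞(Ψ,K) 𝔖(Ψ))^{m+1}` up to the relative + absolute error `ε ((β_∞ 𝔖)^{m+1} + N^{m+1})`, uniformly over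
`‖Ψ‖_N ≤ L` and convex `K ⊆ [-N,N]` (relative, because `sup_Ψ 𝔖(Ψ) ≍ (log log N)^{t-1}` is unbounded). -/
def SingularMean : Prop :=
  ∀ (m t L : ℕ), 1 ≤ t → ∀ ε : ℝ, 0 < ε → ∃ N₀ : ℕ, ∀ N : ℕ, N₀ ≤ N →
    ∀ Ψ : Fin t → AffLinForm 1, IsNondegenerateSystem Ψ → affLinSize Ψ N ≤ L →
      ∀ K : Set (Fin 1 → ℝ), Convex ℝ K → K ⊆ realBox 1 N →
        |∑ H ∈ (shiftBox m N).filter (fun H => IsNondegenerateSystem (translateFamily Ψ H)),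
              archFactor (translateFamily Ψ H) (meetTranslates K H) *
                singularProduct (translateFamily Ψ H)
            - (archFactor Ψ K * singularProduct Ψ) ^ (m + 1)| ≤
          ε * ((archFactor Ψ K * singularProduct Ψ) ^ (m + 1) + (N : ℝ) ^ (m + 1))

/-- The GLUE of B2: local averages + uniform tails + degenerate count + archimedean facts ⟹
`SingularMean` (cover the shift box by cubes of side `primorial y_N ≤ N^{0.35}`; on a cube the weight
`w` varies by `O(m N^{0.35})` and the truncated singular products average exactly; tails are uniform;
degenerate shifts and the crude bound `∏_{p ≤ y} β_p ≤ y^T` cost `O(N^m log^T N)`). -/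
def SingularMeanGlue : Prop :=
  LocalAverage → SingularTail → DegenerateCount → ArchFacts → SingularMean

/-- THE ATOM — COARSE TWO-SIDED HARDY–LITTLEWOOD WITH SUB-EXPONENTIAL DIMENSION LOSS AND `o(N)` SLACK:
some `g` with `g(T)/T → 0` such that for all `T ≥ 1`, `L`, `η > 0`, eventually in `N`, uniformly over
non-degenerate `T`-systems `Φ` with `‖Φ‖_N ≤ L` and convex `K ⊆ [-N, N]`,
`S(Φ,K) ≤ e^{g(T)} β_∞𝔖 + ηN` and `e^{-g(T)} β_∞𝔖 ≤ S(Φ,K) + ηN`.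
Open-problem strength (it is EQUIVALENT to the crux: `coarseHLSlack_of_relativeDimOne` below and
`stub_amplification`); it is the card's `CoarseHL` (threshold form `β_∞𝔖 ≥ ηN`, no slack) plus the
classical uniform upper-bound sieve for linear-form tuples. Its upper half alone is Siegel-zero-hard
(card `gallagher-backwards-split`). -/
def CoarseHLSlack : Prop :=
  ∃ g : ℕ → ℝ, Tendsto (fun T : ℕ => g T / T) atTop (𝓝 0) ∧
    ∀ (T L : ℕ), 1 ≤ T → ∀ η : ℝ, 0 < η → ∃ N₀ : ℕ, ∀ N : ℕ, N₀ ≤ N →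
      ∀ Φ : Fin T → AffLinForm 1, IsNondegenerateSystem Φ → affLinSize Φ N ≤ L →
        ∀ K : Set (Fin 1 → ℝ), Convex ℝ K → K ⊆ realBox 1 N →
          vonMangoldtSum Φ K N ≤
              Real.exp (g T) * (archFactor Φ K * singularProduct Φ) + η * N ∧
            Real.exp (-g T) * (archFactor Φ K * singularProduct Φ) ≤
              vonMangoldtSum Φ K N + η * N

/-- THE TRANSFER: complete sums + averaged main terms + few degenerate shifts turn the atom into the
crux. Given `t, L, ε`: `g` from the atom; `κ = ε e^{-g(t)}/4` separates LOW MASS (`β_∞𝔖 < κN`: the atom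
at dimension `t` with slack `ε/4` gives `S ≤ εN/2`, and `|S − M| ≤ max(S, M)`) from HIGH MASS; there,
with `m` so large that `|g((m+1)t)| ≤ (m+1) log(1 + ε/4)`, `T = (m+1)t`, `L' = (3m+1)L`:
`S^{m+1} = ∑_H S_H ≤ e^{g(T)} ∑_{nondeg} M_H + (4N+1)^m η'N + #deg · (2N+1) log^T(2L'N)` and
`S^{m+1} ≥ e^{-g(T)} ∑_{nondeg} M_H − (4N+1)^m η'N`, so `((1−ε/2)M)^{m+1} ≤ S^{m+1} ≤ ((1+ε/2) M)^{m+1}`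
for small `η', ε₅` and large `N`, whence `|S − M| ≤ ε M / 2` by monotonicity of `x ↦ x^{m+1}` on `ℝ≥0`. -/
def Amplification : Prop :=
  CompleteSum → SingularMean → DegenerateCount → CoarseHLSlack → RelativeDimOne

/-! ### B1 proved: the complete-sum identity -/

/-- `realPoint` of a translated lattice point. -/
theorem realPoint_add (n : Fin 1 → ℤ) (h : ℤ) :
    realPoint (fun l => n l + h) = fun l => realPoint n l + (h : ℝ) := by
  funext l
  simp [realPoint]

/-- Membership of a real lattice point in `K_H`, shift by shift. -/
theorem realPoint_mem_meetTranslates {K : Set (Fin 1 → ℝ)} {H : Fin m → ℤ} {n : Fin 1 → ℤ} :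
    realPoint n ∈ meetTranslates K H ↔
      realPoint n ∈ K ∧ ∀ j : Fin m, realPoint (fun l => n l + H j) ∈ K := by
  simp only [meetTranslates, Set.mem_setOf_eq, Fin.forall_fin_succ, shiftVec_zero, shiftVec_succ,
    Int.cast_zero, add_zero, realPoint_add]

/-- The product of the weights over a translate-constellation splits along the shifts:
`∏_{(j,i)} Λ(ψ_i(n + H'_j)) = (∏_i Λ(ψ_i(n))) · ∏_{j} ∏_i Λ(ψ_i(n + H_j))`. -/
theorem prod_translateFamily (Ψ : Fin t → AffLinForm 1) (H : Fin m → ℤ) (n : Fin 1 → ℤ) :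
    ∏ k, intVonMangoldt ((translateFamily Ψ H k).eval n) =
      (∏ i, intVonMangoldt ((Ψ i).eval n)) *
        ∏ j : Fin m, ∏ i, intVonMangoldt ((Ψ i).eval (fun l => n l + H j)) := by
  rw [← Fintype.prod_equiv finProdFinEquiv
        (fun ji : Fin (m + 1) × Fin t =>
          intVonMangoldt ((translateFamily Ψ H (finProdFinEquiv ji)).eval n))
        (fun k => intVonMangoldt ((translateFamily Ψ H k).eval n)) (fun _ => rfl)]
  rw [Fintype.prod_prod_type]
  simp only [translateFamily_apply, translateForm_eval]
  rw [Fin.prod_univ_succ]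
  simp only [shiftVec_zero, shiftVec_succ, add_zero]

/-- **B1 holds** — the m-fold complete-sum identity
`∑_{H ∈ [-2N,2N]^m} S(Ψ^{(H)}, K_H) = S(Ψ, K)^{m+1}` for `K ⊆ [-N, N]`: unfold the translate-constellation
sum as `∑_{n ∈ K} f(n) ∏_j [n + H_j ∈ K] f(n + H_j)`, sum over `H` first (`Finset.prod_univ_sum`), and in each
shift variable reindex `m_j = n + H_j`, which runs over all of `K ∩ ℤ` because `|m_j − n| ≤ 2N`. -/
theorem completeSum : CompleteSum := by
  classical
  intro m t N Ψ K hK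
  set f : (Fin 1 → ℤ) → ℝ := fun n => ∏ i, intVonMangoldt ((Ψ i).eval n) with hf
  set B := (latticeBox 1 N).filter (fun n => realPoint n ∈ K) with hB
  set φ : (Fin 1 → ℤ) → ℤ → ℝ := fun n h =>
    if realPoint (fun l => n l + h) ∈ K then f (fun l => n l + h) else 0 with hφ
  -- membership in the box from membership of the real point in `K ⊆ [-N, N]`
  have hbox : ∀ n' : Fin 1 → ℤ, realPoint n' ∈ K → n' ∈ latticeBox 1 N := by
    intro n' hn'
    have hm' := hK hn'
    simp only [realBox, Set.mem_Icc] at hm'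
    rw [latticeBox, Fintype.mem_piFinset]
    intro j
    have h1 := hm'.1 j
    have h2 := hm'.2 j
    simp only [realPoint] at h1 h2
    rw [Finset.mem_Icc]
    exact ⟨by exact_mod_cast h1, by exact_mod_cast h2⟩
  -- Step A: each translate-constellation sum as a sum over `B`
  have stepA : ∀ H : Fin m → ℤ, vonMangoldtSum (translateFamily Ψ H) (meetTranslates K H) N =
      ∑ n ∈ B, f n * ∏ j, φ n (H j) := by
    intro H
    unfold vonMangoldtSum
    rw [hB, Finset.sum_filter, Finset.sum_filter]
    refine Finset.sum_congr rfl fun n _ => ?_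
    rw [prod_translateFamily]
    by_cases h1 : realPoint n ∈ K
    · rw [if_pos h1]
      by_cases h2 : ∀ j : Fin m, realPoint (fun l => n l + H j) ∈ K
      · rw [if_pos (realPoint_mem_meetTranslates.mpr ⟨h1, h2⟩)]
        congr 1
        refine Finset.prod_congr rfl fun j _ => ?_
        rw [hφ]
        dsimp only
        rw [if_pos (h2 j)]
      · rw [if_neg (fun h => h2 (realPoint_mem_meetTranslates.mp h).2)]
        push Not at h2
        obtain ⟨j, hj⟩ := h2
        rw [Finset.prod_eq_zero (Finset.mem_univ j) (by rw [hφ]; dsimp only; rw [if_neg hj]), mul_zero]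
    · rw [if_neg (fun h => h1 (realPoint_mem_meetTranslates.mp h).1), if_neg h1]
  -- Step B: the complete sum in ONE shift variable is `S`
  have stepB : ∀ n ∈ B, ∑ h ∈ Finset.Icc (-(2 * N : ℤ)) (2 * N), φ n h = ∑ n' ∈ B, f n' := by
    intro n hn
    rw [hφ]
    dsimp only
    rw [← Finset.sum_filter]
    have hnbox : n ∈ latticeBox 1 N := (Finset.mem_filter.mp hn).1
    rw [latticeBox, Fintype.mem_piFinset] at hnbox
    have hn0 := Finset.mem_Icc.mp (hnbox 0)
    have hfun : ∀ n' : Fin 1 → ℤ, (fun l => n l + (n' 0 - n 0)) = n' := by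
      intro n'
      funext l
      rw [Fin.fin_one_eq_zero l]
      ring
    refine Finset.sum_nbij' (fun h => fun l => n l + h) (fun n' => n' 0 - n 0) ?_ ?_ ?_ ?_ ?_
    · intro h hh
      rw [Finset.mem_filter] at hh
      rw [hB, Finset.mem_filter]
      exact ⟨hbox _ hh.2, hh.2⟩
    · intro n' hn'
      rw [hB, Finset.mem_filter] at hn'
      have hmbox := hn'.1
      rw [latticeBox, Fintype.mem_piFinset] at hmbox
      have hm0 := Finset.mem_Icc.mp (hmbox 0)
      rw [Finset.mem_filter, Finset.mem_Icc]
      refine ⟨⟨by omega, by omega⟩, ?_⟩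
      rw [hfun n']
      exact hn'.2
    · intro h _
      show (n 0 + h) - n 0 = h
      ring
    · intro n' _
      exact hfun n'
    · intro h _
      rfl
  -- assemble: sum over `H` first, product structure of the shift box
  simp_rw [stepA]
  rw [Finset.sum_comm]
  have hin : ∀ n ∈ B, ∑ H ∈ shiftBox m N, f n * ∏ j, φ n (H j) = f n * (∑ n' ∈ B, f n') ^ m := by
    intro n hn
    rw [← Finset.mul_sum, shiftBox,
      ← Finset.prod_univ_sum (fun _ : Fin m => Finset.Icc (-(2 * N : ℤ)) (2 * N)) (fun _ h => φ n h),
      Finset.prod_const, Finset.card_univ, Fintype.card_fin, stepB n hn]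
  rw [Finset.sum_congr rfl hin, ← Finset.sum_mul, pow_succ']
  unfold vonMangoldtSum
  rw [hB]

end Summit.Parity.GeneralizedHardyLittlewood.Cruxes.RelativeDimOne.TranslateAmplification
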